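import Literature.NumberTheory.Automorphic.BianchiCuspCoordinates
import Literature.NumberTheory.Automorphic.BianchiConeTranslates
import Mathlib.Analysis.Convex.Contractible
import Mathlib.Topology.MetricSpace.ProperSpace
import HarnessLib

/-!
# Prototypes for the cover of the Hermitian cone: thick boxes and cusp boxes

Topic `NumberTheory/Automorphic`; namespace `Literature.NumberTheory.Automorphic`, grouping
sub-namespace `BianchiCusp`.  Theorems only (no definition, no `sorry`); the objects
(`hermForm`, `coords`, `thickBox`, `coneOver`, `cuspBox`) are defined in `BianchiCuspCoordinates`.

The open CONVEX pieces of the cone `𝒫` of positive definite binary Hermitian forms whose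
`GL₂(𝓞_K)`-translates form the good cover used for the finiteness of the cohomology of Bianchi
groups ([ElstrodtGrunewaldMennicke1998, Ch. 2 §2.2–2.3, Ch. 7 §7.3]; [BorelSerre1973, §11]):

* `hermForm (p, r, z) = (p z; z̄ r)` and the coordinates `coords M = (Re M₀₀, Re M₁₁, M₀₁)`;
* THICK BOXES `thickBox q ε = coords⁻¹(ball q ε)` (open, convex) and the cone `coneOver` over a
  set (`convex_coneOver`); `exists_thickBox` — around every point of the cone a thick box whose
  trace on the cone lies in a compact subset `hermForm '' closedBall` of the cone;
* CUSP BOXES `cuspBox σ hu δ = {depth_u < 1, |w_u| < δ} ∩ 𝒫` (convex: horoball cones are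
  convex and `|w_u| < δ` is `‖(H_u)₀₁‖ < δ (H_u)₀₀` with `H_u` linear in `H`);
* `contractibleSpace_coe_preimage` — a subset of the cone cut out by a non-empty convex subset of
  `M₂(ℂ)` is contractible (translates of convex sets are convex: `BianchiCone.convex_image_act` of
  `BianchiConeTranslates`).

## References

* J. Elstrodt, F. Grunewald, J. Mennicke, *Groups Acting on Hyperbolic Space* (1998), Ch. 2
  §2.2–2.3, Ch. 7 §7.3 [ElstrodtGrunewaldMennicke1998].
* A. Borel, J.-P. Serre, Comment. Math. Helv. 48 (1973), §11 [BorelSerre1973].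
-/

noncomputable section

open Matrix Complex NumberField
open scoped MatrixGroups ComplexConjugate

namespace Literature.NumberTheory.Automorphic

namespace BianchiCusp

open BianchiCone Literature.NumberTheory.NumberFields

/-! ### Hermitian forms from coordinates -/

/-- `hermForm` is continuous. [folklore] -/
theorem continuous_hermForm : Continuous hermForm := by
  have h1 : Continuous fun q : ℝ × ℝ × ℂ => ((q.1 : ℝ) : ℂ) := Complex.continuous_ofReal.comp continuous_fst
  have h2 : Continuous fun q : ℝ × ℝ × ℂ => q.2.2 := continuous_snd.comp continuous_snd
  have h3 : Continuous fun q : ℝ × ℝ × ℂ => conj q.2.2 := Complex.continuous_conj.comp h2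
  have h4 : Continuous fun q : ℝ × ℝ × ℂ => ((q.2.1 : ℝ) : ℂ) :=
    Complex.continuous_ofReal.comp (continuous_fst.comp continuous_snd)
  refine continuous_pi fun i => continuous_pi fun j => ?_
  fin_cases i <;> fin_cases j
  · exact h1
  · exact h2
  · exact h3
  · exact h4

/-- `coords` is continuous. [folklore] -/
theorem continuous_coords : Continuous coords := by
  have hc : ∀ i j : Fin 2, Continuous fun M : Mat => M i j := fun i j =>
    (continuous_apply j).comp (continuous_apply i)
  exact (Complex.continuous_re.comp (hc 0 0)).prodMk ((Complex.continuous_re.comp (hc 1 1)).prodMk (hc 0 1))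

/-- `coords` is `ℝ`-linear. [folklore] -/
theorem isLinearMap_coords : IsLinearMap ℝ coords := by
  constructor
  · intro M M'
    simp only [coords, Matrix.add_apply, Complex.add_re, Prod.mk_add_mk]
  · intro t M
    simp only [coords, Matrix.smul_apply, Complex.real_smul, Complex.re_ofReal_mul, Prod.smul_mk, smul_eq_mul]

/-- `hdet` of `hermForm`. [folklore] -/
theorem hdet_hermForm (q : ℝ × ℝ × ℂ) : hdet (hermForm q) = q.1 * q.2.1 - Complex.normSq q.2.2 := by
  simp [hdet, hermForm]

/-- `hermForm q` is Hermitian. [folklore] -/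
theorem isHermitian_hermForm (q : ℝ × ℝ × ℂ) : (hermForm q).IsHermitian := by
  rw [hermForm]
  apply Matrix.IsHermitian.ext
  intro i j
  fin_cases i <;> fin_cases j <;> simp [Complex.conj_ofReal]

/-- `hermForm q ∈ 𝒫` when `p > 0` and `p r - |z|² > 0`. [folklore] -/
theorem hermForm_mem_cone {q : ℝ × ℝ × ℂ} (hp : 0 < q.1) (hd : 0 < q.1 * q.2.1 - Complex.normSq q.2.2) :
    hermForm q ∈ cone :=
  ⟨isHermitian_hermForm q, by simpa [hermForm] using hp, by rw [hdet_hermForm]; exact hd⟩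

/-- A Hermitian matrix is the `hermForm` of its coordinates. [folklore] -/
theorem eq_hermForm_coords {M : Mat} (hM : M.IsHermitian) : M = hermForm (coords M) := by
  have h00 := im_apply_self_of_isHermitian hM 0
  have h11 := im_apply_self_of_isHermitian hM 1
  have h10 := apply_one_zero_of_isHermitian hM
  ext i j
  fin_cases i <;> fin_cases j
  · change M 0 0 = ((M 0 0).re : ℂ)
    apply Complex.ext <;> simp [h00]
  · rfl
  · exact h10
  · change M 1 1 = ((M 1 1).re : ℂ)
    apply Complex.ext <;> simp [h11]

/-! ### Thick boxes -/

/-- Thick boxes are open. [folklore] -/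
theorem isOpen_thickBox (q : ℝ × ℝ × ℂ) (ε : ℝ) : IsOpen (thickBox q ε) :=
  Metric.isOpen_ball.preimage continuous_coords

/-- Thick boxes are convex. [folklore] -/
theorem convex_thickBox (q : ℝ × ℝ × ℂ) (ε : ℝ) : Convex ℝ (thickBox q ε) :=
  (convex_ball q ε).is_linear_preimage isLinearMap_coords

/-- **Around every point of the cone there is a thick box whose trace on the cone is contained
in a compact subset of the cone.** [cite: ElstrodtGrunewaldMennicke1998, Ch. 2 §2.2] -/
theorem exists_thickBox {H : Mat} (hH : H ∈ cone) :
    ∃ ε : ℝ, 0 < ε ∧ H ∈ thickBox (coords H) ε ∧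
      IsCompact (hermForm '' Metric.closedBall (coords H) ε) ∧
      hermForm '' Metric.closedBall (coords H) ε ⊆ cone ∧
      cone ∩ thickBox (coords H) ε ⊆ hermForm '' Metric.closedBall (coords H) ε := by
  obtain ⟨hherm, hp, hd⟩ := hH
  -- the open condition in coordinates
  let g : ℝ × ℝ × ℂ → ℝ × ℝ := fun q => (q.1, q.1 * q.2.1 - Complex.normSq q.2.2)
  have hg : Continuous g := continuous_fst.prodMk ((continuous_fst.mul (continuous_fst.comp continuous_snd)).sub
    (Complex.continuous_normSq.comp (continuous_snd.comp continuous_snd)))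
  let U : Set (ℝ × ℝ × ℂ) := g ⁻¹' (Set.Ioi ((H 0 0).re / 2) ×ˢ Set.Ioi (hdet H / 2))
  have hU : IsOpen U := (isOpen_Ioi.prod isOpen_Ioi).preimage hg
  have hHU : coords H ∈ U := by
    refine ⟨?_, ?_⟩
    · change (H 0 0).re / 2 < (H 0 0).re; linarith
    · change hdet H / 2 < (H 0 0).re * (H 1 1).re - Complex.normSq (H 0 1)
      rw [← hdet]; linarith
  obtain ⟨ε₀, hε₀, hball⟩ := Metric.isOpen_iff.1 hU _ hHU
  refine ⟨ε₀ / 2, half_pos hε₀, Metric.mem_ball_self (half_pos hε₀), ?_, ?_, ?_⟩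
  · exact (isCompact_closedBall _ _).image continuous_hermForm
  · rintro _ ⟨q, hq, rfl⟩
    have hqU : q ∈ U := hball (Metric.closedBall_subset_ball (half_lt_self hε₀) hq)
    obtain ⟨h1, h2⟩ := hqU
    change (H 0 0).re / 2 < q.1 at h1
    change hdet H / 2 < q.1 * q.2.1 - Complex.normSq q.2.2 at h2
    exact hermForm_mem_cone (by linarith) (by linarith)
  · rintro M ⟨hMc, hM⟩
    exact ⟨coords M, Metric.ball_subset_closedBall hM, (eq_hermForm_coords hMc.1).symm⟩

/-- **The cone over a convex set is convex.** [folklore] -/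
theorem convex_coneOver {B : Set Mat} (hB : Convex ℝ B) : Convex ℝ (coneOver B) := by
  rintro M ⟨s, hs, hsM⟩ M' ⟨s', hs', hsM'⟩ a b ha hb hab
  -- `a M + b M' = (a/s + b/s') • (convex combination of s M and s' M')`
  set T : ℝ := a / s + b / s' with hT
  have hT0 : 0 < T := by
    rcases ha.lt_or_eq with ha' | rfl
    · exact add_pos_of_pos_of_nonneg (div_pos ha' hs) (div_nonneg hb hs'.le)
    · rw [zero_add] at hab
      rw [hT, hab, zero_div, zero_add]
      exact div_pos one_pos hs'
  refine ⟨T⁻¹, inv_pos.2 hT0, ?_⟩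
  have hmem : (a / s / T) • (s • M) + (b / s' / T) • (s' • M') ∈ B :=
    hB hsM hsM' (div_nonneg (div_nonneg ha hs.le) hT0.le) (div_nonneg (div_nonneg hb hs'.le) hT0.le)
      (by rw [← add_div, div_self hT0.ne'])
  have he : T⁻¹ • (a • M + b • M') = (a / s / T) • (s • M) + (b / s' / T) • (s' • M') := by
    rw [smul_add, smul_smul, smul_smul, smul_smul, smul_smul]
    congr 1
    · congr 1; field_simp
    · congr 1; field_simp
  rw [he]
  exact hmem

/-- The trace of the cone over an open set on the subtype `↥𝒫` is open. [folklore] -/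
theorem isOpen_coe_preimage_coneOver {B : Set Mat} (hB : IsOpen B) :
    IsOpen {x : ↥cone | (x : Mat) ∈ coneOver B} := by
  have h : {x : ↥cone | (x : Mat) ∈ coneOver B} = ⋃ t : {t : ℝ // 0 < t}, {x : ↥cone | (t : ℝ) • (x : Mat) ∈ B} := by
    ext x
    simp only [Set.mem_setOf_eq, coneOver, Set.mem_iUnion]
    exact ⟨fun ⟨t, ht, h⟩ => ⟨⟨t, ht⟩, h⟩, fun ⟨t, h⟩ => ⟨t, t.2, h⟩⟩
  rw [h]
  exact isOpen_iUnion fun t => hB.preimage ((continuous_const_smul (t : ℝ)).comp continuous_subtype_val)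

/-! ### Cusp boxes -/

section Cusp

variable {K : Type*} [Field K] [NumberField K] (σ : K →+* ℂ) {u : OVec K} (hu : u ≠ 0)

/-- The depth at a non-zero vector is continuous on the cone (as a function on the subtype).
[folklore] -/
theorem continuous_depth_restrict {v : OVec K} (hv : v ≠ 0) : Continuous fun x : ↥cone => depth σ v (x : Mat) := by
  unfold depth
  refine ((continuous_qf _).comp continuous_subtype_val).div
    (continuous_const.mul (continuous_rdet.comp continuous_subtype_val)) fun x => ?_
  have hN : (0 : ℝ) < Ideal.absNorm (idealOf v) := by exact_mod_cast absNorm_idealOf_pos hv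
  exact (mul_pos hN (rdet_pos x.2)).ne'

/-- The horizontal coordinate is continuous on the cone (as a function on the subtype). [folklore] -/
theorem continuous_hcoord_restrict : Continuous fun x : ↥cone => hcoord σ hu (x : Mat) :=
  (continuousOn_hcoord σ hu).restrict

/-- The trace of a cusp box on `↥𝒫` is open. [folklore] -/
theorem isOpen_coe_preimage_cuspBox (δ : ℝ) : IsOpen {x : ↥cone | (x : Mat) ∈ cuspBox σ hu δ} := by
  have h : {x : ↥cone | (x : Mat) ∈ cuspBox σ hu δ} =
      {x : ↥cone | depth σ u (x : Mat) < 1} ∩ {x : ↥cone | ‖hcoord σ hu (x : Mat)‖ < δ} := by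
    ext x
    simp only [cuspBox, Set.mem_setOf_eq, Set.mem_inter_iff]
    exact ⟨fun h => ⟨h.2.1, h.2.2⟩, fun h => ⟨x.2, h.1, h.2⟩⟩
  rw [h]
  exact (isOpen_lt (continuous_depth_restrict σ hu) continuous_const).inter
    (isOpen_lt (continuous_norm.comp (continuous_hcoord_restrict σ hu)) continuous_const)

include hu in
/-- On the cone, `depth_u H < 1` iff `H[σu] < N𝔞_u · rdet H`. [folklore] -/
theorem depth_lt_one_iff {H : Mat} (hH : H ∈ cone) :
    depth σ u H < 1 ↔ qf H (emb σ u) < (Ideal.absNorm (idealOf u) : ℝ) * rdet H := by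
  have hN : (0 : ℝ) < Ideal.absNorm (idealOf u) := by exact_mod_cast absNorm_idealOf_pos hu
  unfold depth
  rw [div_lt_one (mul_pos hN (rdet_pos hH))]

/-- On the cone, `|w_u(H)| < δ` iff `‖(H_u)₀₁‖ < δ · Re (H_u)₀₀`. [folklore] -/
theorem norm_hcoord_lt_iff {H : Mat} (hH : H ∈ cone) (δ : ℝ) :
    ‖hcoord σ hu H‖ < δ ↔ ‖cuspForm σ hu H 0 1‖ < δ * (cuspForm σ hu H 0 0).re := by
  have hq : 0 < qf H (emb σ u) := qf_pos hH fun h => hu ((emb_eq_zero_iff σ).1 h)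
  rw [hcoord, norm_div, cuspForm_zero_zero σ hu hH.1, Complex.norm_real, Real.norm_eq_abs, abs_of_pos hq,
    Complex.ofReal_re, div_lt_iff₀ hq]

/-- **Cusp boxes are convex.** [cite: ElstrodtGrunewaldMennicke1998, Ch. 7 §7.3] -/
theorem convex_cuspBox (δ : ℝ) : Convex ℝ (cuspBox σ hu δ) := by
  have hN : (0 : ℝ) ≤ Ideal.absNorm (idealOf u) := Nat.cast_nonneg _
  -- as an intersection of two convex sets
  have h1 : Convex ℝ {H : Mat | H ∈ cone ∧ qf H (emb σ u) < (Ideal.absNorm (idealOf u) : ℝ) * rdet H} :=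
    convex_horoballCone (emb σ u) hN
  have h2 : Convex ℝ {H : Mat | H ∈ cone ∧ ‖cuspForm σ hu H 0 1‖ < δ * (cuspForm σ hu H 0 0).re} := by
    intro H hH H' hH' a b ha hb hab
    refine ⟨convex_cone hH.1 hH'.1 ha hb hab, ?_⟩
    have hlin : cuspForm σ hu (a • H + b • H') = a • cuspForm σ hu H + b • cuspForm σ hu H' := by
      rw [cuspForm, act_add, act_smul, act_smul]; rfl
    rw [hlin]
    simp only [Matrix.add_apply, Matrix.smul_apply, Complex.real_smul, Complex.add_re, Complex.re_ofReal_mul]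
    have hq : 0 < (cuspForm σ hu H 0 0).re := by rw [re_cuspForm_zero_zero]; exact qf_pos hH.1 fun h => hu ((emb_eq_zero_iff σ).1 h)
    have hq' : 0 < (cuspForm σ hu H' 0 0).re := by rw [re_cuspForm_zero_zero]; exact qf_pos hH'.1 fun h => hu ((emb_eq_zero_iff σ).1 h)
    have htri : ‖(a : ℂ) * cuspForm σ hu H 0 1 + (b : ℂ) * cuspForm σ hu H' 0 1‖ ≤
        a * ‖cuspForm σ hu H 0 1‖ + b * ‖cuspForm σ hu H' 0 1‖ := by
      refine (norm_add_le _ _).trans ?_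
      rw [norm_mul, norm_mul, Complex.norm_real, Complex.norm_real, Real.norm_eq_abs, Real.norm_eq_abs,
        abs_of_nonneg ha, abs_of_nonneg hb]
    rcases ha.lt_or_eq with ha' | rfl
    · have := mul_lt_mul_of_pos_left hH.2 ha'
      have := mul_le_mul_of_nonneg_left hH'.2.le hb
      nlinarith
    · rw [zero_add] at hab
      subst hab
      have := hH'.2
      simp only [Complex.ofReal_zero, zero_mul, zero_add, Complex.ofReal_one, one_mul] at htri ⊢
      linarith
  have he : cuspBox σ hu δ = {H : Mat | H ∈ cone ∧ qf H (emb σ u) < (Ideal.absNorm (idealOf u) : ℝ) * rdet H} ∩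
      {H : Mat | H ∈ cone ∧ ‖cuspForm σ hu H 0 1‖ < δ * (cuspForm σ hu H 0 0).re} := by
    ext H
    simp only [cuspBox, Set.mem_setOf_eq, Set.mem_inter_iff]
    constructor
    · rintro ⟨hH, hd, hw⟩
      exact ⟨⟨hH, (depth_lt_one_iff σ hu hH).1 hd⟩, ⟨hH, (norm_hcoord_lt_iff σ hu hH δ).1 hw⟩⟩
    · rintro ⟨⟨hH, hd⟩, ⟨-, hw⟩⟩
      exact ⟨hH, (depth_lt_one_iff σ hu hH).2 hd, (norm_hcoord_lt_iff σ hu hH δ).2 hw⟩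
  rw [he]
  exact h1.inter h2

end Cusp

/-! ### Translates and contractibility -/

/-- **A piece of `↥𝒫` cut out by a non-empty convex subset of `M₂(ℂ)` contained in the cone is
contractible.** [cite: BorelSerre1973, §11] -/
theorem contractibleSpace_coe_preimage {W : Set Mat} (hW : Convex ℝ W) (hWc : W ⊆ cone) (hne : W.Nonempty) :
    ContractibleSpace ↥{x : ↥cone | (x : Mat) ∈ W} := by
  haveI : ContractibleSpace ↥W := hW.contractibleSpace hne
  let e : ↥{x : ↥cone | (x : Mat) ∈ W} ≃ₜ ↥W :=
    { toFun := fun x => ⟨x.1.1, x.2⟩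
      invFun := fun w => ⟨⟨w.1, hWc w.2⟩, w.2⟩
      left_inv := fun x => rfl
      right_inv := fun w => rfl
      continuous_toFun := (continuous_subtype_val.comp continuous_subtype_val).subtype_mk _
      continuous_invFun := (continuous_subtype_val.subtype_mk _).subtype_mk _ }
  exact e.contractibleSpace

end BianchiCusp


end Literature.NumberTheory.Automorphic
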